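import Literature.MathematicalPhysics.QuantumLattice.TorusShellCountUniform
import HarnessLib

/-!
# The inverse-gap sum `Σ 1/|ε_L(k) - μ|` outside an energy window on the torus

Family `hubbard` / topic `MathematicalPhysics/QuantumLattice`. A counting estimate for the band
`ε_L(k) = -2(cos(2πk₁/L) + cos(2πk₂/L))` of the square torus `(ℤ/Lℤ)²` (`torusBand`):

* `sum_inv_abs_sub_le`: for every level `μ` and window `e₀ > 0`,
  `Σ_{k : |ε_L(k) - μ| ≥ e₀} 1/|ε_L(k) - μ| ≤ 4·L²/√e₀ + 4·L/e₀`.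

Proof: 4-adic layer cake — on the shell `e₀4^j ≤ |ε - μ| < e₀4^{j+1}` the uniform shell count
`#{|ε - μ| ≤ η} ≤ √η L² + 2L` (`card_torusShell_le_sqrt`) bounds the contribution by
`2·2^{-j} L²/√e₀ + 2·4^{-j} L/e₀`, two geometric sums, and the tail `|ε - μ| ≥ e₀4^L` contributes at
most `L²/(e₀4^L) ≤ L/e₀`. Uniform in `μ` (including the van Hove level `μ = 0`); with the linear
shell count away from the van Hove level the same layer cake gives `O(L² log(1/e₀))`. This is the
Cauchy–Schwarz weight of the `a^{3/2}` pairing-cost rate (`FreeFermiGasPairingCostOptimal.lean`).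

Sources: folklore lattice-point counting; J. Bardeen, L. N. Cooper, J. R. Schrieffer, Phys. Rev. 108
(1957) 1175, §II (the logarithmic `Σ_k 1/|ξ_k|` of the gap equation). No named facts, no
definitions.

## Mathlib / tree search

Tree: `card_torusShell_le_sqrt`, `card_torusSite`, `sum_geomWeight_card_shell_le` (a differently
weighted dyadic shell sum). Mathlib: `exists_nat_pow_near`, `Nat.lt_pow_self`, `Finset.sum_ite_mem`,
`Finset.single_le_sum`, `Finset.sum_comm`, `geom_sum_Ico_le_of_lt_one`, `div_le_div_of_nonneg_left`.
-/

noncomputable section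

namespace Literature.MathematicalPhysics.QuantumLattice

open Matrix Finset Literature.Probability.LatticeModels
open scoped ComplexOrder ComplexConjugate

/-! ### The inverse-gap sum outside an energy window -/

section InverseGap

variable {L : ℕ} [NeZero L]

/-- **Inverse-gap sum on the torus.** For every level `μ` and window `e₀ > 0`:
`Σ_{k : |ε_L(k) - μ| ≥ e₀} 1/|ε_L(k) - μ| ≤ 4·L²/√e₀ + 4·L/e₀` (4-adic layer cake: on the shell
`e₀4^j ≤ |ε - μ| < e₀4^{j+1}` the uniform count `#{|ε - μ| ≤ η} ≤ √η L² + 2L` gives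
`2·2^{-j} L²/√e₀ + 2·4^{-j} L/e₀`, and the tail `|ε - μ| ≥ e₀ 4^L` at most `L²/(e₀4^L) ≤ L/e₀`).
Uniform in `μ`, including the van Hove level. [folklore] -/
theorem sum_inv_abs_sub_le (μ : ℝ) {e₀ : ℝ} (he : 0 < e₀) :
    ∑ k ∈ Finset.univ.filter (fun k : TorusSite 2 L => e₀ ≤ |torusBand L k - μ|),
        1 / |torusBand L k - μ| ≤
      4 * (L : ℝ) ^ 2 / Real.sqrt e₀ + 4 * L / e₀ := by
  classical
  set s : ℝ := Real.sqrt e₀ with hs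
  have hs0 : 0 < s := Real.sqrt_pos.2 he
  have hse : s ^ 2 = e₀ := Real.sq_sqrt he.le
  set J : ℕ := L with hJ
  set A : ℕ → Finset (TorusSite 2 L) := fun j => Finset.univ.filter fun k : TorusSite 2 L =>
      e₀ * 4 ^ j ≤ |torusBand L k - μ| ∧ |torusBand L k - μ| < e₀ * 4 ^ (j + 1) with hA
  set T : Finset (TorusSite 2 L) := Finset.univ.filter fun k : TorusSite 2 L =>
      e₀ * 4 ^ J ≤ |torusBand L k - μ| with hT
  have hL0 : (0 : ℝ) ≤ L := Nat.cast_nonneg _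
  have hLpos : (0 : ℝ) < L := Nat.cast_pos.2 (Nat.pos_of_ne_zero (NeZero.ne L))
  have hs' : s ≠ 0 := hs0.ne'
  -- pointwise layer cake
  have hpt : ∀ k : TorusSite 2 L, e₀ ≤ |torusBand L k - μ| →
      1 / |torusBand L k - μ| ≤
        ∑ j ∈ Finset.range J, (if k ∈ A j then 1 / (e₀ * 4 ^ j) else 0) +
          (if k ∈ T then 1 / (e₀ * 4 ^ J) else 0) := by
    intro k hk
    have hξ : 0 < |torusBand L k - μ| := lt_of_lt_of_le he hk
    have hterm0 : ∀ j ∈ Finset.range J, (0 : ℝ) ≤ if k ∈ A j then 1 / (e₀ * 4 ^ j) else 0 := by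
      intro j _
      split_ifs <;> positivity
    have htail0 : (0 : ℝ) ≤ if k ∈ T then 1 / (e₀ * 4 ^ J) else 0 := by split_ifs <;> positivity
    obtain ⟨j, hj1, hj2⟩ := exists_nat_pow_near (x := |torusBand L k - μ| / e₀) (y := (4 : ℝ))
      (by rwa [le_div_iff₀ he, one_mul]) (by norm_num)
    rw [le_div_iff₀ he] at hj1
    rw [div_lt_iff₀ he] at hj2
    by_cases hjJ : j < J
    · have hkA : k ∈ A j := by
        simp only [hA, Finset.mem_filter, Finset.mem_univ, true_and]
        exact ⟨by linarith, by linarith⟩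
      have hle : 1 / |torusBand L k - μ| ≤ 1 / (e₀ * 4 ^ j) :=
        one_div_le_one_div_of_le (by positivity) (by linarith)
      have hsingle : (if k ∈ A j then 1 / (e₀ * 4 ^ j) else 0 : ℝ) ≤
          ∑ j ∈ Finset.range J, (if k ∈ A j then 1 / (e₀ * 4 ^ j) else 0) :=
        Finset.single_le_sum hterm0 (Finset.mem_range.2 hjJ)
      rw [if_pos hkA] at hsingle
      linarith
    · push Not at hjJ
      have h4 : (e₀ * 4 ^ J : ℝ) ≤ e₀ * 4 ^ j :=
        mul_le_mul_of_nonneg_left (pow_le_pow_right₀ (by norm_num) hjJ) he.le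
      have hkT : k ∈ T := by
        simp only [hT, Finset.mem_filter, Finset.mem_univ, true_and]
        linarith
      have hle : 1 / |torusBand L k - μ| ≤ 1 / (e₀ * 4 ^ J) :=
        one_div_le_one_div_of_le (by positivity) (by linarith)
      rw [if_pos hkT]
      have := Finset.sum_nonneg hterm0
      linarith
  -- shell counts
  have hA_card : ∀ j, ((A j).card : ℝ) ≤ 2 ^ (j + 1) * s * (L : ℝ) ^ 2 + 2 * L := by
    intro j
    have hsub : A j ⊆ Finset.univ.filter
        (fun k : TorusSite 2 L => |torusBand L k - μ| ≤ e₀ * 4 ^ (j + 1)) := by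
      intro k hk
      simp only [hA, Finset.mem_filter] at hk ⊢
      exact ⟨hk.1, hk.2.2.le⟩
    have h1 : ((A j).card : ℝ) ≤ ((Finset.univ.filter
        (fun k : TorusSite 2 L => |torusBand L k - μ| ≤ e₀ * 4 ^ (j + 1))).card : ℝ) := by
      exact_mod_cast Finset.card_le_card hsub
    have h2 := card_torusShell_le_sqrt (L := L) μ (e₀ * 4 ^ (j + 1))
    have hsqrt : Real.sqrt (e₀ * 4 ^ (j + 1)) = 2 ^ (j + 1) * s := by
      rw [show (e₀ * 4 ^ (j + 1) : ℝ) = (2 ^ (j + 1) * s) ^ 2 by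
        rw [mul_pow, hse, ← pow_mul, pow_mul' (2 : ℝ) (j + 1) 2]; norm_num; ring]
      exact Real.sqrt_sq (by positivity)
    rw [hsqrt] at h2
    exact h1.trans h2
  have hT_card : ((T.card : ℕ) : ℝ) ≤ (L : ℝ) ^ 2 := by
    have := Finset.card_le_univ T
    rw [card_torusSite] at this
    exact_mod_cast this
  -- sum the pointwise bound
  calc ∑ k ∈ Finset.univ.filter (fun k : TorusSite 2 L => e₀ ≤ |torusBand L k - μ|),
        1 / |torusBand L k - μ|
      ≤ ∑ k ∈ Finset.univ.filter (fun k : TorusSite 2 L => e₀ ≤ |torusBand L k - μ|),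
          (∑ j ∈ Finset.range J, (if k ∈ A j then 1 / (e₀ * 4 ^ j) else 0) +
            (if k ∈ T then 1 / (e₀ * 4 ^ J) else 0)) :=
        Finset.sum_le_sum fun k hk => hpt k (Finset.mem_filter.1 hk).2
    _ ≤ ∑ k, (∑ j ∈ Finset.range J, (if k ∈ A j then 1 / (e₀ * 4 ^ j) else 0) +
            (if k ∈ T then 1 / (e₀ * 4 ^ J) else 0)) := by
        apply Finset.sum_le_sum_of_subset_of_nonneg (Finset.filter_subset _ _)
        intro k _ _
        refine add_nonneg (Finset.sum_nonneg fun j _ => ?_) ?_ <;> split_ifs <;> positivity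
    _ = ∑ j ∈ Finset.range J, ((A j).card : ℝ) * (1 / (e₀ * 4 ^ j)) +
          (T.card : ℝ) * (1 / (e₀ * 4 ^ J)) := by
        rw [Finset.sum_add_distrib, Finset.sum_comm]
        congr 1
        · refine Finset.sum_congr rfl fun j _ => ?_
          rw [Finset.sum_ite_mem, Finset.univ_inter, Finset.sum_const, nsmul_eq_mul]
        · rw [Finset.sum_ite_mem, Finset.univ_inter, Finset.sum_const, nsmul_eq_mul]
    _ ≤ ∑ j ∈ Finset.range J, (2 * (L : ℝ) ^ 2 / s * (1 / 2 : ℝ) ^ j + 2 * L / e₀ * (1 / 4 : ℝ) ^ j) +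
          (L : ℝ) / e₀ := by
        refine add_le_add (Finset.sum_le_sum fun j _ => ?_) ?_
        · have h := mul_le_mul_of_nonneg_right (hA_card j) (show (0 : ℝ) ≤ 1 / (e₀ * 4 ^ j) by positivity)
          refine h.trans (le_of_eq ?_)
          have h4 : (4 : ℝ) ^ j = 2 ^ j * 2 ^ j := by rw [← mul_pow]; norm_num
          rw [← hse, h4, pow_succ, _root_.one_div_pow, _root_.one_div_pow, h4]
          field_simp
        · -- the tail: `|T| / (e₀ 4^L) ≤ L² / (e₀ L) = L / e₀`
          have h4L : (L : ℝ) ≤ (4 : ℝ) ^ J := by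
            rw [hJ]
            exact_mod_cast (Nat.lt_pow_self (by norm_num : 1 < 4)).le
          have hpos : (0 : ℝ) < e₀ * 4 ^ J := by positivity
          calc (T.card : ℝ) * (1 / (e₀ * 4 ^ J)) ≤ (L : ℝ) ^ 2 * (1 / (e₀ * 4 ^ J)) :=
                mul_le_mul_of_nonneg_right hT_card (by positivity)
            _ = (L : ℝ) ^ 2 / (e₀ * 4 ^ J) := by ring
            _ ≤ (L : ℝ) ^ 2 / (e₀ * L) :=
                div_le_div_of_nonneg_left (by positivity) (mul_pos he hLpos)
                  (mul_le_mul_of_nonneg_left h4L he.le)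
            _ = (L : ℝ) / e₀ := by
                field_simp
    _ = 2 * (L : ℝ) ^ 2 / s * ∑ j ∈ Finset.range J, (1 / 2 : ℝ) ^ j +
          2 * L / e₀ * ∑ j ∈ Finset.range J, (1 / 4 : ℝ) ^ j + (L : ℝ) / e₀ := by
        rw [Finset.sum_add_distrib, ← Finset.mul_sum, ← Finset.mul_sum]
    _ ≤ 2 * (L : ℝ) ^ 2 / s * 2 + 2 * L / e₀ * (4 / 3) + (L : ℝ) / e₀ := by
        have hg2 : ∑ j ∈ Finset.range J, (1 / 2 : ℝ) ^ j ≤ 2 := by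
          have := geom_sum_Ico_le_of_lt_one (x := (1 / 2 : ℝ)) (m := 0) (n := J)
            (by norm_num) (by norm_num)
          rw [Finset.range_eq_Ico]
          refine this.trans ?_
          norm_num
        have hg4 : ∑ j ∈ Finset.range J, (1 / 4 : ℝ) ^ j ≤ 4 / 3 := by
          have := geom_sum_Ico_le_of_lt_one (x := (1 / 4 : ℝ)) (m := 0) (n := J)
            (by norm_num) (by norm_num)
          rw [Finset.range_eq_Ico]
          refine this.trans ?_
          norm_num
        have ha : 0 ≤ 2 * (L : ℝ) ^ 2 / s := by positivity
        have hb : 0 ≤ 2 * (L : ℝ) / e₀ := by positivity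
        linarith [mul_le_mul_of_nonneg_left hg2 ha, mul_le_mul_of_nonneg_left hg4 hb]
    _ ≤ 4 * (L : ℝ) ^ 2 / Real.sqrt e₀ + 4 * L / e₀ := by
        rw [← hs]
        have : 0 ≤ (L : ℝ) / e₀ := by positivity
        have key : 2 * (L : ℝ) ^ 2 / s * 2 + 2 * L / e₀ * (4 / 3) + (L : ℝ) / e₀ =
            4 * (L : ℝ) ^ 2 / s + 4 * L / e₀ - (1 / 3) * ((L : ℝ) / e₀) := by ring
        rw [key]
        linarith

end InverseGap

end Literature.MathematicalPhysics.QuantumLattice
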